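import Summits.BirchSwinnertonDyer.BirchSwinnertonDyer.Theorems.KolyvaginRankRigidityAtTwoRegularValueEngineTwoLevel
import Summits.BirchSwinnertonDyer.BirchSwinnertonDyer.Theorems.KolyvaginRankRigidityAtTwoWalkEngineBasis
import Summits.BirchSwinnertonDyer.BirchSwinnertonDyer.Theorems.KolyvaginRankRigidityAtTwoWalkEngineCharacter
import Summits.BirchSwinnertonDyer.BirchSwinnertonDyer.Theorems.KolyvaginRankRigidityAtTwoWalkStepTransfer
import HarnessLib

/-!
# Crux U1 `KolyvaginBoundedDefectAtTwo` (stmt-BirchSwinnertonDyer-28083), LINE 17 `regular_core_rigidity` v3,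
# stub S1b `stub_nearCoreExistenceAtTwo` — ENGINE ADAPTER III: a regular Kolyvagin prime killing prescribed frame
# classes and cutting prescribed eigenclasses with their quotient order

Width seat `bsd-line-krr2-p2` g14 (ONE READER on S1b); `--supports stmt-BirchSwinnertonDyer-28083` (helper). THEOREMS
ONLY; nothing here proves S1b, U1, a rung or BSD. BSD is NOT proved.

**`exists_regular_kolyvaginPrime_killing`** — the form of the value engine the walk consumes. Data: a finite
`τ_*`-stable `S ≤ H¹(K, E[2^k])` (the current vertex `H¹_{𝓕(c)}`), eigenclasses `y i ∈ S` to be KEPT and eigenclasses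
`p, q ∈ S` to be CUT. Conclusion: beyond any bound there is a Zhang–Kolyvagin prime `ℓ` at `2` of index `≥ k+1`,
REGULAR at level `2^k` (the clause `hreg` of g13's step lemmas), such that at the place `v ∣ ℓ`: `loc_v (y i) = 0` for
all `i`, and for `x ∈ {p, q}`: `a • loc_v x = 0 ↔ a • x ∈ ⟨y⟩ + ker(res)` (restriction to `Γ_{K(E[2^(k+1)])}`), i.e.
`loc_v x` has exactly the order of `x` modulo the kept classes. ASSEMBLY: restricted basis (`exists_restricted_basis`)
+ killing character (`exists_killing_character`, values `α i` on the basis) + two-level value engine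
(`exists_regular_kolyvaginPrime_values_twoLevel`, p688489; Čebotarev = the tree's proved
`Automorphic.chebotarev_artinRep_of_galoisSide`) + Φ-kill and exact-order transfer (`…WalkStepTransfer`).
References (locators only): [cite: MazurRubin2004, §4.1, Prop. 4.1.5] [cite: McCallumLMS1991, §3 Prop. 3.1]
[cite: GrossLMS1991, §9].
Design: no definitions; `K : Type`; axioms `propext`, `Classical.choice`, `Quot.sound`.
-/

set_option autoImplicit false
-- the Theorems namespace of this sub repeats the summit name by design (D-0017 nested layout)
set_option linter.dupNamespace false

noncomputable section

open scoped Classical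
open Function WeierstrassCurve Field Finset NumberField IsDedekindDomain
open Literature.NumberTheory Literature.NumberTheory.EllipticCurves Literature.NumberTheory.EllipticCurves.KolyvaginPairing
open Literature.NumberTheory.GaloisRepresentations
open Summit.BirchSwinnertonDyer.BirchSwinnertonDyer.Theorems.KolyvaginAtTwo.RegularRefill
  (localization_eq_zero_of_forall_h1Eval_eq_zero addOrderOf_localization_eq_two_pow)

namespace Summit.BirchSwinnertonDyer.BirchSwinnertonDyer.Theorems.KolyvaginAtTwo.RegularValueEngine

variable {K : Type} [Field K] [NumberField K] (W : WeierstrassCurve ℚ)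

/-! ### §1 Small helpers -/

/-- `2^k ∣ 2^N s` iff `2^N • s = 0` in `ZMod 2^k`. [folklore] -/
theorem two_pow_dvd_mul_iff_nsmul_cast_eq_zero (k N : ℕ) (s : ℤ) :
    (2 : ℤ) ^ k ∣ 2 ^ N * s ↔ (2 ^ N) • ((s : ℤ) : ZMod (2 ^ k)) = 0 := by
  have h2 : ((2 ^ k : ℕ) : ℤ) = (2 : ℤ) ^ k := by rw [Nat.cast_pow, Nat.cast_ofNat]
  rw [← h2, ← ZMod.intCast_zmod_eq_zero_iff_dvd, Int.cast_mul, Int.cast_pow, Int.cast_ofNat, nsmul_eq_mul,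
    Nat.cast_pow, Nat.cast_ofNat]

/-- An element killed by `2^N` but not by `2^(N−1)` (when `N ≠ 0`) has order `2^N`. [folklore] -/
theorem addOrderOf_eq_two_pow_of_minimal {A : Type*} [AddCommGroup A] {x : A} {N : ℕ} (h1 : (2 ^ N) • x = 0)
    (h2 : N ≠ 0 → (2 ^ (N - 1)) • x ≠ 0) : addOrderOf x = 2 ^ N := by
  rcases Nat.eq_zero_or_pos N with rfl | hpos
  · rw [pow_zero, one_nsmul] at h1
    rw [h1, addOrderOf_zero, pow_zero]
  · obtain ⟨n, rfl⟩ : ∃ n, N = n + 1 := ⟨N - 1, (Nat.sub_add_cancel hpos).symm⟩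
    haveI : Fact (Nat.Prime 2) := ⟨Nat.prime_two⟩
    exact addOrderOf_eq_prime_pow (by simpa using h2 (Nat.succ_ne_zero n)) h1

/-- `τ_*` preserves "same restriction to `Γ_{K(E[2^(k+1)])}`" (an involutive lift of `τ` conjugates
`Γ_{K(E[2^(k+1)])}` into itself; `[τ_* x, ρ] = τ̃ [x, τ̃ρτ̃]`). [cite: GrossLMS1991, §9] -/
theorem forall_h1Eval_conjAct_eq (hK : IsImaginaryQuadratic K) {τ : K ≃ₐ[ℚ] K} (hτ : τ ≠ 1) {k : ℕ}
    {x x' : galH1Torsion (W.baseChange K) ((2 ^ k : ℕ) : ℤ)}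
    (h : ∀ ρ ∈ torsionFixing (W.baseChange K) ((2 ^ (k + 1) : ℕ) : ℤ),
      h1Eval (W.baseChange K) ((2 ^ k : ℕ) : ℤ) x ρ = h1Eval (W.baseChange K) ((2 ^ k : ℕ) : ℤ) x' ρ) :
    ∀ ρ ∈ torsionFixing (W.baseChange K) ((2 ^ (k + 1) : ℕ) : ℤ),
      h1Eval (W.baseChange K) ((2 ^ k : ℕ) : ℤ) (conjAct W τ ((2 ^ k : ℕ) : ℤ) x) ρ =
        h1Eval (W.baseChange K) ((2 ^ k : ℕ) : ℤ) (conjAct W τ ((2 ^ k : ℕ) : ℤ) x') ρ := by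
  obtain ⟨c₀, hc₀⟩ := exists_isComplexConjugation (Rat.castHom ℝ)
  have ht : IsLiftOfAut τ (absGaloisTransport (K := ℚ) (L := K) c₀).toRingEquiv :=
    RatClosure.isLiftOfAut_absGaloisTransport_of_isImaginaryQuadratic hK hτ hc₀
  have hinv : ∀ z, (absGaloisTransport (K := ℚ) (L := K) c₀).toRingEquiv
      ((absGaloisTransport (K := ℚ) (L := K) c₀).toRingEquiv z) = z := fun z ↦
    RatClosure.absGaloisTransport_absGaloisTransport_of_sq_eq_one hc₀.sq_eq_one z
  have hle : torsionFixing (W.baseChange K) ((2 ^ (k + 1) : ℕ) : ℤ) ≤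
      torsionFixing (W.baseChange K) ((2 ^ k : ℕ) : ℤ) :=
    KolyvaginLowerBoundAtTwo.torsionFixing_le_of_dvd _ (natCast_two_pow_dvd_succ k)
  intro ρ hρ
  rw [ht.h1Eval_conjAct W _ x (hle hρ), ht.h1Eval_conjAct W _ x' (hle hρ),
    h _ (ht.conjGalCMH_mem_torsionFixing W hinv _ hρ)]

/-! ### §2 The adapter -/

/-- **A REGULAR KOLYVAGIN PRIME KILLING THE KEPT CLASSES AND CUTTING `p`, `q` WITH THEIR QUOTIENT ORDERS.**
See the module docstring. [cite: MazurRubin2004, §4.1, Prop. 4.1.5] [cite: McCallumLMS1991, §3 Prop. 3.1] -/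
theorem exists_regular_kolyvaginPrime_killing [W.IsElliptic] [W.IsGloballyMinimal] [NeZero (W.conductorNorm ℤ)]
    (hK : IsImaginaryQuadratic K) (hodd : Odd (NumberField.discr K))
    (hH : SatisfiesHeegnerHypothesis (W.conductorNorm ℤ) K) {k : ℕ} (hk : 1 ≤ k)
    (hρ2 : W.HasSurjectiveModNGaloisRep 2) (hsurj : W.HasSurjectiveModNGaloisRep ((2 ^ (k + 1) : ℕ) : ℤ))
    {τ : K ≃ₐ[ℚ] K} (hτ : τ ≠ 1)
    (S : AddSubgroup (galH1Torsion (W.baseChange K) ((2 ^ k : ℕ) : ℤ))) [Finite S]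
    (hSτ : ∀ x ∈ S, conjAct W τ ((2 ^ k : ℕ) : ℤ) x ∈ S)
    {m : ℕ} (y : Fin m → galH1Torsion (W.baseChange K) ((2 ^ k : ℕ) : ℤ)) (hy : ∀ i, y i ∈ S)
    (sy : Fin m → ℤ) (hyτ : ∀ i, conjAct W τ ((2 ^ k : ℕ) : ℤ) (y i) = sy i • y i)
    {p q : galH1Torsion (W.baseChange K) ((2 ^ k : ℕ) : ℤ)} (hp : p ∈ S) (hq : q ∈ S) {sp sq : ℤ}
    (hpτ : conjAct W τ ((2 ^ k : ℕ) : ℤ) p = sp • p) (hqτ : conjAct W τ ((2 ^ k : ℕ) : ℤ) q = sq • q) (bnd : ℕ) :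
    ∃ ℓ : ℕ, bnd < ℓ ∧ Zhang2014.IsKolyvaginPrime (W.conductorNorm ℤ) W K 2 ℓ ∧
      k + 1 ≤ Zhang2014.kolyvaginIndex W 2 ℓ ∧
      (∃ (v₁ : HeightOneSpectrum (𝓞 ℚ)) (𝔓₁ : Ideal (absIntegers (𝓞 ℚ) ℚ)) (h : absoluteGaloisGroup ℚ),
        (ℓ : 𝓞 ℚ) ∈ v₁.asIdeal ∧ 𝔓₁ ∈ v₁.primesAbove ∧ IsArithFrobAt (𝓞 ℚ) h 𝔓₁ ∧
        (∀ X : geomTorsion W ((2 ^ k : ℕ) : ℤ), h • h • X = X) ∧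
        ∃ P : geomTorsion W ((2 ^ k : ℕ) : ℤ), (2 : ℤ) ^ (k - 1) • (P + h • P) ≠ 0) ∧
      ∀ v : HeightOneSpectrum (𝓞 K), (ℓ : 𝓞 K) ∈ v.asIdeal →
        (∀ i, galoisCohomology.localization ((W.baseChange K).torsionGaloisModule ((2 ^ k : ℕ) : ℤ))
          (Sum.inr v : Place K) 1 (y i) = 0) ∧
        (∀ a : ℤ, a • galoisCohomology.localization ((W.baseChange K).torsionGaloisModule ((2 ^ k : ℕ) : ℤ))
            (Sum.inr v : Place K) 1 p = 0 ↔
          ∃ b : Fin m → ℤ, ∀ ρ ∈ torsionFixing (W.baseChange K) ((2 ^ (k + 1) : ℕ) : ℤ),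
            h1Eval (W.baseChange K) ((2 ^ k : ℕ) : ℤ) (a • p - ∑ i, b i • y i) ρ = 0) ∧
        (∀ a : ℤ, a • galoisCohomology.localization ((W.baseChange K).torsionGaloisModule ((2 ^ k : ℕ) : ℤ))
            (Sum.inr v : Place K) 1 q = 0 ↔
          ∃ b : Fin m → ℤ, ∀ ρ ∈ torsionFixing (W.baseChange K) ((2 ^ (k + 1) : ℕ) : ℤ),
            h1Eval (W.baseChange K) ((2 ^ k : ℕ) : ℤ) (a • q - ∑ i, b i • y i) ρ = 0) := by
  -- notation
  haveI : NeZero (2 ^ k) := ⟨by positivity⟩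
  have hle : torsionFixing (W.baseChange K) ((2 ^ (k + 1) : ℕ) : ℤ) ≤
      torsionFixing (W.baseChange K) ((2 ^ k : ℕ) : ℤ) :=
    KolyvaginLowerBoundAtTwo.torsionFixing_le_of_dvd _ (natCast_two_pow_dvd_succ k)
  obtain ⟨c₀, hc₀⟩ := exists_isComplexConjugation (Rat.castHom ℝ)
  -- basis and character
  obtain ⟨r, cs, Tm, e, hcsS, hT, he, hind, hspan⟩ := exists_restricted_basis W τ S hSτ
  obtain ⟨f, hfres, hfy, hfp, hfq⟩ := exists_killing_character W S y hy hp hq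
  let α : Fin r → ℤ := fun i ↦ ((f ⟨cs i, hcsS i⟩).val : ℤ)
  have hα' : ∀ i, ((α i : ℤ) : ZMod (2 ^ k)) = f ⟨cs i, hcsS i⟩ := fun i ↦ by
    simp only [α, Int.cast_natCast, ZMod.natCast_zmod_val]
  -- value identities
  have hE1 : ∀ (a : Fin r → ℤ) (x : galH1Torsion (W.baseChange K) ((2 ^ k : ℕ) : ℤ)) (hx : x ∈ S),
      (∀ ρ ∈ torsionFixing (W.baseChange K) ((2 ^ (k + 1) : ℕ) : ℤ),
        h1Eval (W.baseChange K) ((2 ^ k : ℕ) : ℤ) x ρ =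
          h1Eval (W.baseChange K) ((2 ^ k : ℕ) : ℤ) (∑ i, a i • cs i) ρ) →
      (((∑ i, a i * α i : ℤ)) : ZMod (2 ^ k)) = f ⟨x, hx⟩ := by
    intro a x hx hax
    have hmem : ∑ i, a i • cs i ∈ S := S.sum_mem fun i _ ↦ S.zsmul_mem (hcsS i) _
    have h1 : f ⟨x, hx⟩ = f ⟨∑ i, a i • cs i, hmem⟩ := hfres _ _ hax
    have h2 : (⟨∑ i, a i • cs i, hmem⟩ : S) = ∑ i, a i • (⟨cs i, hcsS i⟩ : S) :=
      Subtype.ext (by rw [AddSubgroup.val_finsetSum]; simp only [AddSubgroup.coe_zsmul])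
    rw [h1, h2, map_sum, Int.cast_sum]
    refine Finset.sum_congr rfl fun i _ ↦ ?_
    rw [map_zsmul, Int.cast_mul, hα', zsmul_eq_mul]
  have hTcs : ∀ i, (((∑ l, Tm i l * α l : ℤ)) : ZMod (2 ^ k)) =
      f ⟨conjAct W τ ((2 ^ k : ℕ) : ℤ) (cs i), hSτ _ (hcsS i)⟩ := fun i ↦ hE1 (Tm i) _ _ (hT i)
  have hE2 : ∀ (a : Fin r → ℤ) (x : galH1Torsion (W.baseChange K) ((2 ^ k : ℕ) : ℤ)) (hx : x ∈ S),
      (∀ ρ ∈ torsionFixing (W.baseChange K) ((2 ^ (k + 1) : ℕ) : ℤ),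
        h1Eval (W.baseChange K) ((2 ^ k : ℕ) : ℤ) x ρ =
          h1Eval (W.baseChange K) ((2 ^ k : ℕ) : ℤ) (∑ i, a i • cs i) ρ) →
      (((∑ i, a i * ∑ l, Tm i l * α l : ℤ)) : ZMod (2 ^ k)) =
        f ⟨conjAct W τ ((2 ^ k : ℕ) : ℤ) x, hSτ x hx⟩ := by
    intro a x hx hax
    have hmem : ∑ i, a i • conjAct W τ ((2 ^ k : ℕ) : ℤ) (cs i) ∈ S :=
      S.sum_mem fun i _ ↦ S.zsmul_mem (hSτ _ (hcsS i)) _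
    have hax' := forall_h1Eval_conjAct_eq W hK hτ hax
    have h1 : f ⟨conjAct W τ ((2 ^ k : ℕ) : ℤ) x, hSτ x hx⟩ =
        f ⟨∑ i, a i • conjAct W τ ((2 ^ k : ℕ) : ℤ) (cs i), hmem⟩ := by
      refine hfres _ _ fun ρ hρ ↦ ?_
      rw [hax' ρ hρ, map_sum]
      simp only [map_zsmul]
    have h2 : (⟨∑ i, a i • conjAct W τ ((2 ^ k : ℕ) : ℤ) (cs i), hmem⟩ : S) =
        ∑ i, a i • (⟨conjAct W τ ((2 ^ k : ℕ) : ℤ) (cs i), hSτ _ (hcsS i)⟩ : S) :=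
      Subtype.ext (by rw [AddSubgroup.val_finsetSum]; simp only [AddSubgroup.coe_zsmul])
    rw [h1, h2, map_sum, Int.cast_sum]
    refine Finset.sum_congr rfl fun i _ ↦ ?_
    rw [map_zsmul, Int.cast_mul, hTcs, zsmul_eq_mul]
  -- `hα`
  have hα : ∀ i, (2 : ℤ) ^ k ∣ 2 ^ e i * α i := by
    intro i
    rw [two_pow_dvd_mul_iff_nsmul_cast_eq_zero, hα', ← map_nsmul]
    have h0 : f ((2 ^ e i) • ⟨cs i, hcsS i⟩) = f ⟨0, S.zero_mem⟩ := by
      refine hfres _ _ fun ρ hρ ↦ ?_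
      have hc : ((2 ^ e i : ℕ) : ℤ) = (2 : ℤ) ^ e i := by rw [Nat.cast_pow, Nat.cast_ofNat]
      rw [AddSubgroup.coe_nsmul, ← natCast_zsmul, h1Eval_zsmul _ _ _ _ (hle hρ), h1Eval_zero _ _ (hle hρ), hc]
      exact he i ρ hρ
    rw [h0]
    exact map_zero f
  -- the exact-order exponents, by minimality
  have hPk : ∀ s t : ℤ, (2 : ℤ) ^ k ∣ 2 ^ k * s ∧ (2 : ℤ) ^ k ∣ 2 ^ k * t := fun s t ↦ ⟨dvd_mul_right _ _, dvd_mul_right _ _⟩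
  let Nb : Fin r → ℕ := fun i ↦ Nat.find (⟨k, hPk (α i) (∑ j, Tm i j * α j)⟩ :
    ∃ N : ℕ, (2 : ℤ) ^ k ∣ 2 ^ N * α i ∧ (2 : ℤ) ^ k ∣ 2 ^ N * ∑ j, Tm i j * α j)
  have hNb : ∀ i, (2 : ℤ) ^ k ∣ 2 ^ Nb i * α i ∧ (2 : ℤ) ^ k ∣ 2 ^ Nb i * ∑ j, Tm i j * α j ∧
      (Nb i ≠ 0 → ¬ ((2 : ℤ) ^ k ∣ 2 ^ (Nb i - 1) * α i ∧ (2 : ℤ) ^ k ∣ 2 ^ (Nb i - 1) * ∑ j, Tm i j * α j)) := by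
    intro i
    have hs := Nat.find_spec (⟨k, hPk (α i) (∑ j, Tm i j * α j)⟩ :
      ∃ N : ℕ, (2 : ℤ) ^ k ∣ 2 ^ N * α i ∧ (2 : ℤ) ^ k ∣ 2 ^ N * ∑ j, Tm i j * α j)
    refine ⟨hs.1, hs.2, fun h0 ↦ Nat.find_min _ (Nat.sub_lt (Nat.pos_of_ne_zero h0) Nat.one_pos)⟩
  -- the combinations: `y i`, `p`, `q`
  let z : Fin (m + 2) → galH1Torsion (W.baseChange K) ((2 ^ k : ℕ) : ℤ) := Fin.snoc (Fin.snoc y p) q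
  have hzy : ∀ i : Fin m, z (Fin.castSucc (Fin.castSucc i)) = y i := fun i ↦ by
    simp only [z, Fin.snoc_castSucc]
  have hzp : z (Fin.castSucc (Fin.last m)) = p := by simp only [z, Fin.snoc_castSucc, Fin.snoc_last]
  have hzq : z (Fin.last (m + 1)) = q := by simp only [z, Fin.snoc_last]
  have hz : ∀ j, z j ∈ S := by
    intro j
    refine Fin.lastCases ?_ (fun j' ↦ Fin.lastCases ?_ (fun i ↦ ?_) j') j
    · rw [hzq]; exact hq
    · rw [hzp]; exact hp
    · rw [hzy]; exact hy i
  choose a ha using fun j ↦ hspan (z j) (hz j)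
  let Nq : Fin (m + 2) → ℕ := fun j ↦ Nat.find (⟨k, hPk (∑ i, a j i * α i) (∑ i, a j i * ∑ l, Tm i l * α l)⟩ :
    ∃ N : ℕ, (2 : ℤ) ^ k ∣ 2 ^ N * ∑ i, a j i * α i ∧ (2 : ℤ) ^ k ∣ 2 ^ N * ∑ i, a j i * ∑ l, Tm i l * α l)
  have hNq : ∀ j, (2 : ℤ) ^ k ∣ 2 ^ Nq j * ∑ i, a j i * α i ∧
      (2 : ℤ) ^ k ∣ 2 ^ Nq j * ∑ i, a j i * ∑ l, Tm i l * α l ∧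
      (Nq j ≠ 0 → ¬ ((2 : ℤ) ^ k ∣ 2 ^ (Nq j - 1) * ∑ i, a j i * α i ∧
        (2 : ℤ) ^ k ∣ 2 ^ (Nq j - 1) * ∑ i, a j i * ∑ l, Tm i l * α l)) := by
    intro j
    have hs := Nat.find_spec (⟨k, hPk (∑ i, a j i * α i) (∑ i, a j i * ∑ l, Tm i l * α l)⟩ :
      ∃ N : ℕ, (2 : ℤ) ^ k ∣ 2 ^ N * ∑ i, a j i * α i ∧ (2 : ℤ) ^ k ∣ 2 ^ N * ∑ i, a j i * ∑ l, Tm i l * α l)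
    refine ⟨hs.1, hs.2, fun h0 ↦ Nat.find_min _ (Nat.sub_lt (Nat.pos_of_ne_zero h0) Nat.one_pos)⟩
  -- translation of the divisibility predicate
  have hPiff : ∀ (j : Fin (m + 2)) (N : ℕ),
      ((2 : ℤ) ^ k ∣ 2 ^ N * ∑ i, a j i * α i ∧ (2 : ℤ) ^ k ∣ 2 ^ N * ∑ i, a j i * ∑ l, Tm i l * α l) ↔
      ((2 ^ N) • f ⟨z j, hz j⟩ = 0 ∧ (2 ^ N) • f ⟨conjAct W τ ((2 ^ k : ℕ) : ℤ) (z j), hSτ _ (hz j)⟩ = 0) := by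
    intro j N
    rw [two_pow_dvd_mul_iff_nsmul_cast_eq_zero, two_pow_dvd_mul_iff_nsmul_cast_eq_zero, hE1 (a j) _ (hz j) (ha j),
      hE2 (a j) _ (hz j) (ha j)]
  -- THE ENGINE
  obtain ⟨ρ, -, -, -, hprimes⟩ := exists_regular_kolyvaginPrime_values_twoLevel
    Automorphic.chebotarev_artinRep_of_galoisSide hK hodd hH hk hρ2 hsurj hc₀ hτ cs Tm hT e he hind α hα Nb hNb a Nq hNq
  obtain ⟨ℓ, hℓb, hKol, hidx, -, hreg, -, hloc⟩ := hprimes bnd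
  refine ⟨ℓ, hℓb, hKol, hidx, hreg, fun v hv ↦ ?_⟩
  -- at the place `v`
  set loc := galoisCohomology.localization ((W.baseChange K).torsionGaloisModule ((2 ^ k : ℕ) : ℤ))
    (Sum.inr v : Place K) 1 with hlocdef
  -- `loc (z j) = loc (∑ a j i • cs i)` (Φ-kill) and its exact order
  have hlz : ∀ j, loc (z j) = loc (∑ i, a j i • cs i) := fun j ↦ by
    rw [← sub_eq_zero, ← map_sub]
    refine localization_eq_zero_of_forall_h1Eval_eq_zero W hK hKol hidx v hv fun ρ' hρ' ↦ ?_
    have hs : h1Eval (W.baseChange K) ((2 ^ k : ℕ) : ℤ) (z j - ∑ i, a j i • cs i) ρ' =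
        h1Eval (W.baseChange K) ((2 ^ k : ℕ) : ℤ) (z j) ρ' - h1Eval (W.baseChange K) ((2 ^ k : ℕ) : ℤ) (∑ i, a j i • cs i) ρ' :=
      map_sub (h1EvalHom (W.baseChange K) ((2 ^ k : ℕ) : ℤ) (hle hρ')) (z j) (∑ i, a j i • cs i)
    exact hs.trans (sub_eq_zero.mpr (ha j ρ' hρ'))
  have hordz : ∀ j, addOrderOf (loc (z j)) = 2 ^ Nq j := fun j ↦ by
    rw [hlz]
    exact addOrderOf_localization_eq_two_pow W v (hloc j v hv).1 (hloc j v hv).2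
  -- `f` at `z j` and at `τ_* (z j)`
  have hfz : ∀ (j : Fin (m + 2)) (x : galH1Torsion (W.baseChange K) ((2 ^ k : ℕ) : ℤ)) (hx : x ∈ S) (s : ℤ),
      z j = x → conjAct W τ ((2 ^ k : ℕ) : ℤ) x = s • x →
      f ⟨z j, hz j⟩ = f ⟨x, hx⟩ ∧ f ⟨conjAct W τ ((2 ^ k : ℕ) : ℤ) (z j), hSτ _ (hz j)⟩ = s • f ⟨x, hx⟩ := by
    intro j x hx s hjx hxs
    subst hjx
    refine ⟨rfl, ?_⟩
    rw [← map_zsmul]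
    exact congrArg f (Subtype.ext (by rw [AddSubgroup.coe_zsmul]; exact hxs))
  -- the order of `f` at an eigenclass `x = z j` is `2 ^ Nq j`
  have hordf : ∀ (j : Fin (m + 2)) (x : galH1Torsion (W.baseChange K) ((2 ^ k : ℕ) : ℤ)) (hx : x ∈ S) (s : ℤ),
      z j = x → conjAct W τ ((2 ^ k : ℕ) : ℤ) x = s • x → addOrderOf (f ⟨x, hx⟩) = 2 ^ Nq j := by
    intro j x hx s hjx hxs
    obtain ⟨h1, h2⟩ := hfz j x hx s hjx hxs
    obtain ⟨hA, -, hmin⟩ := hNq j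
    refine addOrderOf_eq_two_pow_of_minimal ?_ fun h0 hc ↦ hmin h0 ?_
    · have := ((hPiff j (Nq j)).mp ⟨hA, (hNq j).2.1⟩).1
      rwa [h1] at this
    · rw [hPiff, h1, h2, smul_comm, hc, smul_zero]
      exact ⟨rfl, rfl⟩
  -- conclusion for a cutter
  have hcut : ∀ (j : Fin (m + 2)) (x : galH1Torsion (W.baseChange K) ((2 ^ k : ℕ) : ℤ)) (hx : x ∈ S) (s : ℤ),
      z j = x → conjAct W τ ((2 ^ k : ℕ) : ℤ) x = s • x →
      ∀ a' : ℤ, a' • loc x = 0 ↔ a' • f ⟨x, hx⟩ = 0 := by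
    intro j x hx s hjx hxs a'
    rw [← addOrderOf_dvd_iff_zsmul_eq_zero, ← addOrderOf_dvd_iff_zsmul_eq_zero, hordf j x hx s hjx hxs, ← hjx,
      hordz j]
  refine ⟨fun i ↦ ?_, fun a' ↦ (hcut _ p hp sp hzp hpτ a').trans (hfp a'),
    fun a' ↦ (hcut _ q hq sq hzq hqτ a').trans (hfq a')⟩
  -- killing: `Nq = 0` at `y i`
  have h0 : Nq (Fin.castSucc (Fin.castSucc i)) = 0 := by
    have h1 : addOrderOf (f ⟨y i, hy i⟩) = 2 ^ Nq (Fin.castSucc (Fin.castSucc i)) :=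
      hordf _ (y i) (hy i) (sy i) (hzy i) (hyτ i)
    rw [hfy i, addOrderOf_zero] at h1
    exact (Nat.pow_eq_one.mp h1.symm).resolve_left (by norm_num)
  have := hordz (Fin.castSucc (Fin.castSucc i))
  rw [h0, pow_zero, AddMonoid.addOrderOf_eq_one_iff, hzy] at this
  exact this

end Summit.BirchSwinnertonDyer.BirchSwinnertonDyer.Theorems.KolyvaginAtTwo.RegularValueEngine

end
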